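import Literature.NumberTheory.Transcendental.ZilberField
import Literature.NumberTheory.Transcendental.Zilber
import Literature.NumberTheory.Transcendental.ZilberProofs
import Literature.NumberTheory.Transcendental.ZilberThm15
import Literature.NumberTheory.Transcendental.IntersectionsWithTori
import Literature.Barriers.Schanuel.AxiomsDoNotForceSchanuel
import HarnessLib

/-!
# Placement of Exponential-Algebraic Closedness relative to Schanuel's conjecture

Where Zilber's Exponential-Algebraic Closedness for `ℂ_exp`
(`Literature.NumberTheory.Transcendental.IsExpAlgClosed ℂ`, EAC; its case ladder is
`Literature/ModelTheory/Zilber/EAC.lean`) sits relative to Schanuel's conjecture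
(`Literature.ModelTheory.ExponentialFields.SchanuelProperty ℂ`, to which the summit statement
`Schanuel = Literature.Periods.SchanuelConjecture` unfolds by `Iff.rfl`), assembled from theorems
and named facts already in the tree. Every arrow below is either a THEOREM of the tree or carries its
unproved input as an explicit hypothesis; nothing open is asserted.

| arrow | status | tree |
|---|---|---|
| Zilber (`ℂ_exp ≅ 𝔹`, `ZilberConjecture`) ⟹ SC ∧ EAC | theorem | `zilberConjecture_imp_schanuel_and_isExpAlgClosed` (Bays–Kirby 2018 Thm 1.4 `⟹`, `IsStronglyExpAlgClosed.isExpAlgClosed`) |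
| Zilber ⟺ SC ∧ SEAC | theorem | `Literature.NumberTheory.Transcendental.zilberConjecture_iff_schanuelConjecture_and_isStronglyExpAlgClosed` (Bays–Kirby 2018 Thm 1.4) |
| Zilber ⟺ SC ∧ EAC | granted CIT and Kirby–Zilber 2014 Thm 1.5 (named fact) | `zilberConjecture_iff_schanuel_and_isExpAlgClosed_of_cit` (this file) |
| EAC ⟹ quasiminimality of `ℂ_exp` | theorem | `isExpAlgClosed_imp_zilberQuasiminimalityConjecture` (Bays–Kirby 2018 Thm 1.5, tree proof `isQuasiminimal_of_isExpAlgClosed_holds`) |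
| EAC ⟹ SC | NOT known, not expected | Aslanyan–Gallinaro 2024 §3.5: "There are no known implications between Schanuel's conjecture and Exponential Closedness (and it is not expected that there are any)"; formally, Zilber's other axioms (EAC in Kirby's linear-independence form, standard kernel, CCP, quasiminimality, cardinality `𝔠`) do not force SP: `Literature.Barriers.Schanuel.not_softDerivationOfSchanuel`, `Literature.Barriers.Schanuel.exists_isSoftZilberField_not_schanuelProperty` (Bays–Kirby 2018 §9.2, models `𝔹_P`) |
| SC ⟹ EAC | NOT known | SC gives only the transcendence half: SC ⟹ (EAC ⟹ SEAC) granted CIT (Kirby–Zilber 2014 Thm 1.5, `Literature.NumberTheory.Transcendental.kirbyZilber2014_isStronglyExpAlgClosed_of_isExpAlgClosed`); one variable: SC ⟹ strong EC for curves (Marker 2006 Thm 1.6 over `ℚ^{alg}`, Mantova 2016 Thm 1.2) |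
| SC ⟹ SEAC in ONE variable (generic solutions of `p(z, e^z) = 0`) | theorem in print (Mantova–Zannier 2016 Thm 1.2; Marker 2006 for `p ∈ ℚ^{alg}[x,y]`), typed as the named fact `mantovaZannier2016_thm_1_2` (`SchanuelProperty ℂ → ∀ k = ℚ(S) f.g., ∀ p, … → HasGenericExpZero S p`, this file); the existence of solutions is unconditional (Marker 2006 Cor 2.4, `Literature.ModelTheory.Zilber.marker2006_cor_2_4`, proved in `EACDensityProofs.lean`) | `HasGenericExpZero`, `mantovaZannier2016_thm_1_2`, `hasGenericExpZero_of_schanuel`, `zeroLocus_inter_expGraph_nonempty_of_schanuel` |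

HONEST FRAMING (pub-schanuel): the EAC case ladder consists of modest rungs of EAC; it is NOT
Schanuel's conjecture, and EAC does not imply Schanuel (no implication is known or expected). What
EAC buys unconditionally is quasiminimality of `ℂ_exp` (Zilber's weak conjecture), and, together
WITH Schanuel's conjecture (and CIT for the EAC/SEAC coincidence), Zilber's categoricity conjecture
`ℂ_exp ≅ 𝔹`.

## References
* M. Bays, J. Kirby, *Pseudo-exponential maps, variants, and quasiminimality*, Algebra & Number
  Theory 12 (2018) 493–549, Thms 1.4, 1.5, §9.2.
* J. Kirby, B. Zilber, *Exponentially closed fields and the conjecture on intersections with tori*,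
  APAL 165 (2014) 1680–1706, Thm 1.5.
* V. Aslanyan, F. Gallinaro, arXiv:2409.12860 (2024), §3.5.
* D. Marker, J. Symb. Logic 71 (2006), Thm 1.6; V. Mantova (appendix with U. Zannier),
  *Polynomial-exponential equations and Zilber's conjecture*, BLMS 48 (2016) 309–320
  (arXiv:1402.0685), Conjecture 1.1 and Thm 1.2 (p. 3 of the arXiv version).
-/

noncomputable section

namespace Literature.ModelTheory.Zilber

open Literature.NumberTheory.Transcendental Literature.ModelTheory.ExponentialFields

/-- **Zilber's conjecture lies strictly above both Schanuel and EAC**: `ℂ_exp ≅ 𝔹`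
(`ZilberConjecture = IsZilberField ℂ`) gives Schanuel's conjecture (axiom 3) and
exponential-algebraic closedness (axiom 4, SEAC, implies EAC). [cite: BaysKirby2018ANT, Thm 1.4] -/
theorem zilberConjecture_imp_schanuel_and_isExpAlgClosed (h : ZilberConjecture) :
    SchanuelProperty ℂ ∧ IsExpAlgClosed ℂ :=
  ⟨h.schanuelConjecture, (show IsZilberField ℂ from h).isStronglyExpAlgClosed.isExpAlgClosed⟩

/-- **EAC gives Zilber's WEAK conjecture (quasiminimality of `ℂ_exp`) — unconditionally in
Schanuel** (Bays–Kirby 2018, Thm 1.5, proved in the tree as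
`isQuasiminimal_of_isExpAlgClosed_holds`; "Schanuel's conjecture is not required as a condition for
quasiminimality"). Stated with the named conjecture decl
`Literature.ModelTheory.ExponentialFields.ZilberQuasiminimalityConjecture` as conclusion.
[cite: BaysKirby2018ANT, Thm 1.5] -/
theorem isExpAlgClosed_imp_zilberQuasiminimalityConjecture (hEAC : IsExpAlgClosed ℂ) :
    ZilberQuasiminimalityConjecture :=
  zilberQuasiminimalityConjecture_iff.mpr (isQuasiminimal_of_isExpAlgClosed_holds hEAC)

/-- **Zilber ⟺ Schanuel ∧ EAC, granted CIT** (Bays–Kirby 2018 Thm 1.4 combined with Kirby–Zilber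
2014 Thm 1.5: under Schanuel's conjecture and the Conjecture on Intersections with Tori, EAC and
SEAC coincide for `ℂ_exp`). The two unproved inputs are explicit hypotheses: the Kirby–Zilber named
fact `kirbyZilber2014_isStronglyExpAlgClosed_of_isExpAlgClosed ℂ` and CIT
(`ConjectureOnIntersectionsWithTori`, open). The other Zilber axioms are theorems for `ℂ_exp`
(`Complex.isAlgClosed`, `hasStandardKernel_complex_holds`, `isSurjectiveOntoUnits_complex`,
`hasCountableClosureProperty_complex_holds`). This is the precise sense in which the EAC ladder is
"the other half" of Zilber's conjecture next to Schanuel — and no more.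
[cite: KirbyZilber2014, Thm 1.5 (= Thm 5.7)] -/
theorem zilberConjecture_iff_schanuel_and_isExpAlgClosed_of_cit
    (hKZ : kirbyZilber2014_isStronglyExpAlgClosed_of_isExpAlgClosed ℂ)
    (hCIT : ConjectureOnIntersectionsWithTori) :
    ZilberConjecture ↔ SchanuelProperty ℂ ∧ IsExpAlgClosed ℂ := by
  refine ⟨zilberConjecture_imp_schanuel_and_isExpAlgClosed, fun h => ?_⟩
  exact IsZilberField.of_isExpAlgClosed_of_cit' hKZ hCIT Complex.isAlgClosed
    hasStandardKernel_complex_holds ExponentialRing.isSurjectiveOntoUnits_complex h.1 h.2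
    hasCountableClosureProperty_complex_holds

/-! ### What the Schanuel property buys on the first rung: genericity (one-variable SEAC) -/

/-- **Generic exponential zero of a plane curve over `k = ℚ(S)`** — the conclusion of Zilber's
strong exponential-algebraic closedness in ONE variable for the pair `(k, p)` as worded by
Mantova–Zannier 2016 §1 (1.1): "there exists `z ∈ ℂ` such that `p(z, e^z) = 0` and
`tr.deg_k(z, e^z) = 1`". Typed with the point `x = (z, e^z)` as an element of
`zeroLocus ℂ (span {p}) ∩ expGraph ℂ 1` (the convention of `Literature.ModelTheory.Zilber.marker2006_cor_2_4`)
and the transcendence degree literally as `Algebra.trdeg k k(z, e^z)`, `k = ℚ(S)` as an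
intermediate field of `ℂ/ℚ`. A predicate on `(S, p)`; nothing is claimed about it here except
through the named fact below. [cite: MantovaZannier2016, §1 (1.1)] -/
def HasGenericExpZero (S : Finset ℂ) (p : MvPolynomial (Fin 1 ⊕ Fin 1) ℂ) : Prop :=
  ∃ x ∈ MvPolynomial.zeroLocus ℂ (Ideal.span {p}) ∩ expGraph ℂ 1,
    Algebra.trdeg ↥(IntermediateField.adjoin ℚ (S : Set ℂ))
      ↥(IntermediateField.adjoin ↥(IntermediateField.adjoin ℚ (S : Set ℂ)) (Set.range x)) = 1

/-- A generic exponential zero is in particular an exponential zero. [folklore] -/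
theorem HasGenericExpZero.nonempty {S : Finset ℂ} {p : MvPolynomial (Fin 1 ⊕ Fin 1) ℂ}
    (h : HasGenericExpZero S p) :
    (MvPolynomial.zeroLocus ℂ (Ideal.span {p}) ∩ expGraph ℂ 1).Nonempty := by
  obtain ⟨x, hx, -⟩ := h
  exact ⟨x, hx⟩

/-- **Mantova–Zannier 2016, Theorem 1.2** (Bull. LMS 48 (2016) 309–320, arXiv:1402.0685 p. 3;
the case of algebraic coefficients is Marker 2006, J. Symb. Logic 71, Thm 1.6): if `ℂ_exp` has the
Schanuel property `SchanuelProperty ℂ` (Lang 1966 p. 30), then "for any finitely generated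
field `k ⊂ ℂ` and for any irreducible `p(x,y) ∈ k[x,y]` such that `∂p/∂x, ∂p/∂y ≠ 0`, there
exists `z ∈ ℂ` such that `p(z, e^z) = 0` and `tr.deg_k(z, e^z) = 1`" (loc. cit. (1.1), Zilber's
strong exponential-algebraic closedness in one variable). Typed for `p ∈ ℂ[X, Y]` irreducible
over `ℂ` with every coefficient in `k = ℚ(S)`, `S ⊂ ℂ` finite (absolute irreducibility implies
irreducibility in `k[x, y]`, so this typing is implied by the printed theorem), and "both
variables appear" as `0 < degreeOf` (equivalent to `∂p/∂x, ∂p/∂y ≠ 0` in characteristic `0`).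
A refereed theorem whose proof (Marker's finite-dimensionality reduction under the Schanuel
property, Günaydin 2011, a function-field theorem of M. Laurent after Zannier 2004) is not
reproduced in the tree; used only as a hypothesis `(h : mantovaZannier2016_thm_1_2)`.
PLACEMENT: this is what the Schanuel property is known to buy on the first rung of the EAC
ladder — genericity of the zeros of `p(z, e^z)`, whose existence (indeed infinitude) is
unconditional (Marker 2006 Cor 2.4, `Literature.ModelTheory.Zilber.marker2006_cor_2_4`).
[cite: MantovaZannier2016, Thm 1.2] -/
def mantovaZannier2016_thm_1_2 : Prop :=
  SchanuelProperty ℂ → ∀ (S : Finset ℂ) (p : MvPolynomial (Fin 1 ⊕ Fin 1) ℂ), Irreducible p →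
    0 < p.degreeOf (Sum.inl 0) → 0 < p.degreeOf (Sum.inr 0) →
    (∀ m, p.coeff m ∈ IntermediateField.adjoin ℚ (S : Set ℂ)) → HasGenericExpZero S p

/-- Every `p ∈ ℂ[X, Y]` has its coefficients in the finitely generated field
`ℚ(coefficients of p)`, so the theorem above applies to every irreducible `p` in which both
variables appear: granted Mantova–Zannier 2016 Thm 1.2 and the Schanuel property, `p(z, e^z) = 0`
has a zero generic over `ℚ(coefficients of p)` — in particular a zero (the unconditional part
being Marker's `marker2006_cor_2_4`). [cite: MantovaZannier2016, Thm 1.2] -/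
theorem hasGenericExpZero_of_schanuel (hMZ : mantovaZannier2016_thm_1_2)
    (hSC : SchanuelProperty ℂ) (p : MvPolynomial (Fin 1 ⊕ Fin 1) ℂ) (hp : Irreducible p)
    (hX : 0 < p.degreeOf (Sum.inl 0)) (hY : 0 < p.degreeOf (Sum.inr 0)) :
    HasGenericExpZero (p.support.image p.coeff) p := by
  classical
  refine hMZ hSC _ p hp hX hY fun m => ?_
  by_cases hm : m ∈ p.support
  · exact IntermediateField.subset_adjoin _ _
      (by simpa using Finset.mem_image_of_mem p.coeff hm)
  · simp [MvPolynomial.notMem_support_iff.mp hm]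

/-- Hence, granted Mantova–Zannier 2016 Thm 1.2, the Schanuel property yields (generic, a
fortiori some) zeros of `p(z, e^z)` for every irreducible `p` in which both variables appear.
[cite: MantovaZannier2016, Thm 1.2] -/
theorem zeroLocus_inter_expGraph_nonempty_of_schanuel (hMZ : mantovaZannier2016_thm_1_2)
    (hSC : SchanuelProperty ℂ) (p : MvPolynomial (Fin 1 ⊕ Fin 1) ℂ) (hp : Irreducible p)
    (hX : 0 < p.degreeOf (Sum.inl 0)) (hY : 0 < p.degreeOf (Sum.inr 0)) :
    (MvPolynomial.zeroLocus ℂ (Ideal.span {p}) ∩ expGraph ℂ 1).Nonempty :=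
  (hasGenericExpZero_of_schanuel hMZ hSC p hp hX hY).nonempty

end Literature.ModelTheory.Zilber
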